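import Mathlib
import Literature.Computability.AlgebraicComplexity.QuantumFunctionalSpectral
import HarnessLib

/-!
# Crux `BirBdGPhaseCoercivity` (stmt-HubbardSuperconductivity-2081, route `BalabanIR`), line
`bcs-dual-persistence` (reshaped, `V := K`) — stub `stub_negProj` (S1, the negative spectral projection)

For a Hermitian matrix `X` there is a Hermitian idempotent `Γ` (the spectral projection onto the strictly
negative eigenvalues) with `Σ_i |λ_i(X)| = Re Tr X - 2 Re Tr (X Γ)`.
Proof: spectral theorem `X = U diag(λ) U⋆` (`U` unitary); `Γ := U diag(1_{λ_i < 0}) U⋆`; then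
`Tr (XΓ) = Σ_i λ_i 1_{λ_i<0}`, `Tr X = Σ_i λ_i`, and `|λ| = λ - 2 λ 1_{λ<0}` pointwise.
No definition is introduced. [folklore]
-/

noncomputable section

set_option linter.dupNamespace false

namespace Summit.HubbardSuperconductivity.HubbardSuperconductivity.Theorems.BirBdGPhaseCoercivity

open Matrix Finset
open scoped ComplexConjugate ComplexOrder

/-- **Negative spectral projection.** For Hermitian `X` there is a Hermitian idempotent `Γ` with
`Σ_i |λ_i(X)| = Re Tr X - 2 Re Tr (XΓ)` (`Γ` = spectral projection onto the negative eigenvalues). [folklore] -/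
theorem stub_negProj {n : Type*} [Fintype n] [DecidableEq n] (X : Matrix n n ℂ) (hX : X.IsHermitian) :
    ∃ Γ : Matrix n n ℂ, Γᴴ = Γ ∧ Γ * Γ = Γ ∧
      ∑ i, |hX.eigenvalues i| = X.trace.re - 2 * (X * Γ).trace.re := by
  obtain ⟨U, hU, -, hXU⟩ :=
    Literature.Computability.AlgebraicComplexity.IsHermitianAux.spectral_factorisation hX
  -- the `0/1` indicator of the strictly negative eigenvalues (diagonal of `Γ` in the eigenbasis)
  obtain ⟨d, hd⟩ : ∃ d : n → ℂ, ∀ i, d i = if hX.eigenvalues i < 0 then (1 : ℂ) else 0 :=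
    ⟨_, fun _ => rfl⟩
  have hdi : ∀ i, d i * d i = d i := by
    intro i
    rw [hd]
    split_ifs <;> simp
  have hdstar : star d = d := by
    funext i
    rw [Pi.star_apply, hd]
    split_ifs <;> simp
  refine ⟨U * diagonal d * star U, ?_, ?_, ?_⟩
  · -- `Γ` is Hermitian
    rw [Matrix.conjTranspose_mul, Matrix.conjTranspose_mul, Matrix.diagonal_conjTranspose, hdstar,
      Matrix.star_eq_conjTranspose, Matrix.conjTranspose_conjTranspose, Matrix.mul_assoc]
  · -- `Γ` is idempotent
    calc U * diagonal d * star U * (U * diagonal d * star U)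
        = U * diagonal d * (star U * U) * diagonal d * star U := by simp only [Matrix.mul_assoc]
      _ = U * diagonal d * star U := by
          rw [hU, Matrix.mul_one, Matrix.mul_assoc U (diagonal d), diagonal_mul_diagonal]
          simp only [hdi]
  · -- the trace identity
    have hev : ∀ i, ((RCLike.ofReal ∘ hX.eigenvalues) i * d i).re
        = if hX.eigenvalues i < 0 then hX.eigenvalues i else 0 := by
      intro i
      rw [Function.comp_apply, hd]
      split_ifs
      · rw [mul_one]
        exact Complex.ofReal_re (hX.eigenvalues i)
      · rw [mul_zero, Complex.zero_re]
    have htrX : X.trace.re = ∑ i, hX.eigenvalues i := by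
      rw [hX.trace_eq_sum_eigenvalues, Complex.re_sum]
      exact Finset.sum_congr rfl fun i _ => Complex.ofReal_re (hX.eigenvalues i)
    have hassoc : U * diagonal (RCLike.ofReal ∘ hX.eigenvalues) * star U * (U * diagonal d * star U)
        = U * (diagonal (RCLike.ofReal ∘ hX.eigenvalues) * (star U * U) * diagonal d) * star U := by
      simp only [Matrix.mul_assoc]
    have htrXΓ : (X * (U * diagonal d * star U)).trace
        = ∑ i, (RCLike.ofReal ∘ hX.eigenvalues) i * d i := by
      conv_lhs => rw [hXU]
      rw [hassoc, hU, Matrix.mul_one, diagonal_mul_diagonal, Matrix.trace_mul_cycle, hU,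
        Matrix.one_mul, Matrix.trace_diagonal]
    rw [htrXΓ, htrX, Complex.re_sum, Finset.mul_sum, ← Finset.sum_sub_distrib]
    refine Finset.sum_congr rfl fun i _ => ?_
    rw [hev]
    split_ifs with h
    · rw [abs_of_neg h]
      ring
    · rw [abs_of_nonneg (not_lt.mp h)]
      ring

end Summit.HubbardSuperconductivity.HubbardSuperconductivity.Theorems.BirBdGPhaseCoercivity

end
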